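import Summits.QuantumFields.BalabanUV.Beta.GAN24.WilsonSectorRow
import Summits.QuantumFields.BalabanUV.Beta.GAN24.ContactAssembly

/-!
# `BalabanUV.Beta.GAN24.WilsonSectorRowHolds` — binder row G-an2-4 / (CONV-C), CT-ROUTE: **hS0 FOR THE CUBIC-WILSON SECTOR OF THE RECURSIVE COMB FAMILY
# (E), UNCONDITIONALLY** — part B's `WilsonSectorRow.exists_hS0_wilsonSec_of_contact` with its hypothesis `hCT` DISCHARGED BY NAME by leaf-01 g58's CT-3c END
# `ContactAssembly.exists_contact_bound` (row owner, `gen19/CT3-MECHANISM-v1.2.md` §B∕§C; one `exact`)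

NOT IN PRINT; OUR PROOF ATTEMPT (of the route; THIS file is a one-line composition).  HONEST FRAMING (cell contract, verbatim): «discharging `BetaPertH` makes
Bałaban's UV stability UNCONDITIONAL — a real constructive-QFT result; it is NOT the continuum limit and NOT the Clay problem.»  HONEST DEPENDENCY (verbatim):
«continuum YM on T⁴ ⇐ BetaPertH ∧ nine spine estimates (0/9 proved); BetaPertH ⇐ (D1) ∧ (D4) ∧ CAP+tail; G-an2-4 gates asym, D1 and NE2/3/4.»  No cited fact, no
wall binder, no `def`, no `def … : Prop`.  WHAT THIS IS: the letter `hSrow` of road FP's LEFT END (`FP.RoadLeftAssemblyRows.d1Drift_left_of_sliceLedger_rows`)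
RESTRICTED to the Wilson lineage `wilsonSecAt` of the COMB family `SrecAt` (leaf-03's `SrecAt_eq_wilsonSecAt_add_bornSecAt`), at the pin `cE = Lc^4`, from `2 ≤ Lc`
alone.  WHAT IT IS NOT: not hS0 for the full `S` (the `bornSecAt` sectors remain), not the sym family `JsB12Sym` (CT-5), not hSdev (CT-4); NEVER «G-an2-4 closed»
as (CONV-C); NOT D1, NOT `BetaPertH`, NOT continuum, NOT Clay.
Unit `b2b-balaban-gan24-p1` (row owner G-an2-4, gen 19), 2026-08-21.
-/

noncomputable section

open Literature.MathematicalPhysics.QuantumFieldTheory.Balaban1983to89.Beta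
open OneStepResolventKernel (LocStencil)
open AffineAveraging (box toSite)
open Summit.QuantumFields.BalabanUV.Beta.HessKerDressedUnits (unitS)
open Summit.QuantumFields.BalabanUV.Beta.GAN24.CombesThomas (sfStep smStep)
open Summit.QuantumFields.BalabanUV.Beta.GAN24.SrecWilsonSector (wilsonSecAt)
open Summit.QuantumFields.BalabanUV.Beta.GAN24.WilsonSectorRow (exists_hS0_wilsonSec_of_contact)
open Summit.QuantumFields.BalabanUV.Beta.GAN24.ContactAssembly (exists_contact_bound)

namespace Summit.QuantumFields.BalabanUV.Beta.GAN24.WilsonSectorRowHolds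

variable {Lc : ℕ} [NeZero Lc]

/-- NOT IN PRINT; OUR PROOF ATTEMPT (the CT-ROUTE, CT-1 → CT-2 → CT-3 assembled).  **hS0 FOR THE CUBIC-WILSON SECTOR OF THE RECURSIVE FAMILY (E),
UNCONDITIONALLY** (`d = 3`, `2 ≤ Lc`, the literal's pin `cE = Lc^4`): ONE constant `Cs` and ONE rate `δS > 0` with, for EVERY in-block root `rr` and EVERY
level `j`, `LocStencil (unitS (sfStep Lc j) (smStep 3 Lc j) (wilsonSecAt Lc (toSite rr) cE j)) Cs δS` — part B's conditional assembly with leaf-01 g58's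
contact-term END `ContactAssembly.exists_contact_bound` plugged in. -/
theorem exists_hS0_wilsonSec (hLc : 2 ≤ Lc) {cE : ℝ} (hcE : cE = (Lc : ℝ) ^ (3 + 1)) :
    ∃ Cs δS : ℝ, 0 < δS ∧ ∀ (rr : Fin (3 + 1) → ℕ), rr ∈ box (3 + 1) Lc →
      ∀ j : ℕ, LocStencil (unitS (sfStep Lc j) (smStep 3 Lc j) (wilsonSecAt Lc (toSite rr) cE j)) Cs δS :=
  exists_hS0_wilsonSec_of_contact hLc hcE (exists_contact_bound (Lc := Lc) hLc)

end Summit.QuantumFields.BalabanUV.Beta.GAN24.WilsonSectorRowHolds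

end
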